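import Summits.QuantumFields.YangMills.Theorems.LuscherReductionDressedRitzLiftLeakageGramFromStatics
import HarnessLib

/-!
# Crux `DressedRitz` (stmt-QuantumFields-20205), line «polyakovlift» r5, stub S-LEAK `stub_liftLeakage` — support XIX:
# S-LEAK needs NO second-moment estimate: (SLOW) ⟸ band width `O(λ/L)λ₀` × the FIRST-MOMENT admixture budget `O(λ²/L)` (S-POS's NEAR currency)

Support module (fleet seat ym-20205-polyakovlift-s1 gen 1; `--supports stmt-QuantumFields-20205`, helper, no closure claim).  After XIV–XVII the located core of
the registered stub `…Cruxes.DressedRitz.PolyakovLift.stub_liftLeakage` is `SlowOutsideCoreAt k` (p546319): per dressed reference lift, (SLOW)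
`Σ_{j∈S}(μ_j − μ_{j₀})²μ_j^{2L}⟨x,χ_j⟩² ≤ C₁(λ³/L²)λ₀²·μ_{j₀}^{2L}w₀` + (OUT) + (CW).  (SLOW) is a SECOND-moment (lever²) sum; but on a slow set whose levers
are at most `W` it is at most `W ×` the FIRST-moment sum `Σ_{j∈S}|μ_j − μ_{j₀}|μ_j^{2L}⟨x,χ_j⟩²` (`slow_of_band_firstMoment`, finite-sum algebra).  With the band
width `W = D(λ/L)λ₀` (the slow set = the zero-mode band of the first shells: fine levels within `O(λ/L)λ₀` of the own level — level information at precision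
`λ/L`, cruder than RED's `λ²/L`; the vacuum term is weightless since `x ⊥ Ω`) and the first-moment budget `C_N(λ²/L)λ₀·μ_{j₀}^{2L}w₀` — the SAME currency as the
NEAR input of the lead's S-POS press-button `LiftPos.coreO5_of_slow_stiff` (p527993: `Σ_j|λ_j − κ|⟨u,ψ_j⟩² + … ≤ (1 − e^{−C₂λ²/L})κ‖u‖²` for the dressed `u`,
whose weights ARE `μ_j^{2L}⟨x,χ_j⟩²`) — one gets (SLOW) with `C₁ = D·C_N`:

* `slow_of_band_firstMoment` — `Σ_{j∈S}(μ_j−μ₀)²a_j ≤ W·Σ_{j∈S}|μ_j−μ₀|a_j` if `|μ_j−μ₀|a_j ≤ W a_j` on `S` (`a_j ≥ 0`);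
* `FirstMomentCoreAt k` — `SlowOutsideCoreAt k` with (SLOW) replaced by (BAND) `|μ_j − μ_{j₀n}|·⟨x_n,χ_j⟩² ≤ D(λ/L)λ₀·⟨x_n,χ_j⟩²` on `S n` and
  (NEAR₁) `Σ_{j∈S n}|μ_j − μ_{j₀n}|μ_j^{2L}⟨x_n,χ_j⟩² ≤ C_N(λ²/L)λ₀·μ_{j₀n}^{2L}⟨x_n,χ_{j₀n}⟩²`, `D·C_N ≤ C₁`;
* ★ `slowOutsideCore_of_firstMomentCore : FirstMomentCoreAt k → SlowOutsideCoreAt k`;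
* ★★★ `liftLeakage_of_statics_and_firstMomentCore : Stmt-text(S-STAT) → (∀ k, FirstMomentCoreAt k) → Stmt-text(S-LEAK)` (VERBATIM r5 texts).

UPSHOT for the crux map: the renormalisation-group content of S-LEAK is (NEAR₁) [= S-POS's first-moment admixture budget, relative to the own dressed weight]
+ (BAND) [levels of the slow set within `O(λ/L)λ₀` of the own level] + (OUT) [`L`-uniform out-of-band weight `O(λ³)`, time 0] + (CW) [fine splitting of
accidental one-site degeneracies] — no clause of second-moment grade remains; the time-dressing `K_β^[L]` supplies every `L⁻²`.  Not proved here; no claim on the stub.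

HONEST FRAMING: finite-sum algebra + quantifier plumbing at fixed lattice on the conditional femto rung R2b1; `stub_liftLeakage` stays OPEN; nothing here bears on
infinite volume, the continuum limit or the Clay gap.
References: M. Lüscher, NPB 219 (1983) 233 [cite: Luscher1983, §3]; M. Lüscher, U. Wolff, NPB 339 (1990) 222 [cite: LuscherWolff1990, §2];
T. Kato, J. Phys. Soc. Japan 4 (1949) 334 [cite: Kato1949, §1].
-/

set_option autoImplicit false

noncomputable section

open MeasureTheory Filter Topology Finset
open Literature.MathematicalPhysics.QuantumFieldTheory
open Literature.MathematicalPhysics.QuantumLattice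
open scoped BigOperators

namespace Summit.QuantumFields.YangMills.Theorems.FemtoTransferGap.LiftLeak

open Summit.QuantumFields.YangMills.Theorems.FemtoTransferGap
open Summit.QuantumFields.YangMills.Theorems.FemtoTransferGap.PolyakovLift
open Summit.QuantumFields.YangMills.Theorems.FemtoTransferGap.VacDict

/-! ## §1 Second moment ≤ band width × first moment -/

/-- **`Σ_{j∈S}(μ_j − μ₀)²·a_j ≤ W·Σ_{j∈S}|μ_j − μ₀|·a_j`** when `|μ_j − μ₀|·a_j ≤ W·a_j` on `S` (each term: `(μ_j−μ₀)²a_j = |μ_j−μ₀|·(|μ_j−μ₀|a_j)`).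
[folklore] -/
theorem slow_of_band_firstMoment {ι : Type*} (S : Finset ι) (μ a : ι → ℝ) (μ₀ W : ℝ)
    (hband : ∀ j ∈ S, |μ j - μ₀| * a j ≤ W * a j) :
    ∑ j ∈ S, (μ j - μ₀) ^ 2 * a j ≤ W * ∑ j ∈ S, |μ j - μ₀| * a j := by
  rw [mul_sum]
  refine sum_le_sum fun j hj => ?_
  have habs : 0 ≤ |μ j - μ₀| := abs_nonneg _
  calc (μ j - μ₀) ^ 2 * a j = |μ j - μ₀| * (|μ j - μ₀| * a j) := by rw [← mul_assoc, ← sq, sq_abs]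
    _ ≤ |μ j - μ₀| * (W * a j) := mul_le_mul_of_nonneg_left (hband j hj) habs
    _ = W * (|μ j - μ₀| * a j) := by ring

/-- The femto instance: with dressing factors, `a_j = μ_j^{2m}⟨x,χ_j⟩²`, band width `W`, first-moment budget `B`:
`Σ_{j∈S}(μ_j−μ₀)²μ_j^{2m}⟨x,χ_j⟩² ≤ W·B`. [folklore] -/
theorem slow_of_band_firstMoment_dressed {M : ℕ} (S : Finset (Fin M)) (μ : Fin M → ℝ) (w : Fin M → ℝ) (μ₀ W B : ℝ) (m : ℕ)
    (hW : 0 ≤ W) (hband : ∀ j ∈ S, |μ j - μ₀| * w j ^ 2 ≤ W * w j ^ 2)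
    (hnear : ∑ j ∈ S, |μ j - μ₀| * μ j ^ (2 * m) * w j ^ 2 ≤ B) :
    ∑ j ∈ S, (μ j - μ₀) ^ 2 * μ j ^ (2 * m) * w j ^ 2 ≤ W * B := by
  have hpow : ∀ j, 0 ≤ μ j ^ (2 * m) := fun j => by rw [pow_mul']; exact sq_nonneg _
  have h1 : ∑ j ∈ S, (μ j - μ₀) ^ 2 * μ j ^ (2 * m) * w j ^ 2 = ∑ j ∈ S, (μ j - μ₀) ^ 2 * (μ j ^ (2 * m) * w j ^ 2) :=
    sum_congr rfl fun j _ => by ring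
  have h2 : ∑ j ∈ S, |μ j - μ₀| * μ j ^ (2 * m) * w j ^ 2 = ∑ j ∈ S, |μ j - μ₀| * (μ j ^ (2 * m) * w j ^ 2) :=
    sum_congr rfl fun j _ => by ring
  rw [h1]
  rw [h2] at hnear
  have hband' : ∀ j ∈ S, |μ j - μ₀| * (μ j ^ (2 * m) * w j ^ 2) ≤ W * (μ j ^ (2 * m) * w j ^ 2) := fun j hj => by
    have := mul_le_mul_of_nonneg_left (hband j hj) (hpow j)
    calc |μ j - μ₀| * (μ j ^ (2 * m) * w j ^ 2) = μ j ^ (2 * m) * (|μ j - μ₀| * w j ^ 2) := by ring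
      _ ≤ μ j ^ (2 * m) * (W * w j ^ 2) := this
      _ = W * (μ j ^ (2 * m) * w j ^ 2) := by ring
  calc ∑ j ∈ S, (μ j - μ₀) ^ 2 * (μ j ^ (2 * m) * w j ^ 2)
      ≤ W * ∑ j ∈ S, |μ j - μ₀| * (μ j ^ (2 * m) * w j ^ 2) :=
        slow_of_band_firstMoment S μ (fun j => μ j ^ (2 * m) * w j ^ 2) μ₀ W hband'
    _ ≤ W * B := mul_le_mul_of_nonneg_left hnear hW

/-! ## §2 The first-moment core and the closing implication -/

/-- **`FirstMomentCoreAt k`** — `SlowOutsideCoreAt k` with the second-moment clause (SLOW) replaced by the band width (BAND) `|μ_j − μ_{j₀n}|⟨x_n,χ_j⟩² ≤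
D(λ/L)λ₀⟨x_n,χ_j⟩²` on the slow set and the FIRST-moment admixture budget (NEAR₁) `Σ_{j∈S n}|μ_j − μ_{j₀n}|μ_j^{2L}⟨x_n,χ_j⟩² ≤ C_N(λ²/L)λ₀·μ_{j₀n}^{2L}⟨x_n,χ_{j₀n}⟩²`
(`D, C_N ≥ 0`, `D·C_N ≤ C₁`); everything else as in `SlowOutsideCoreAt`. [cite: Luscher1983, §3] [cite: LuscherWolff1990, §2] -/
def FirstMomentCoreAt (k : ℕ) : Prop :=
  ∃ (N : ℕ) (C lam0 : ℝ), 0 ≤ C ∧ 0 < lam0 ∧ ∀ lam : ℝ, 0 < lam → lam ≤ lam0 → ∃ L0 : ℕ,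
    ∀ (L : ℕ) [NeZero L], L0 ≤ L → ∀ β : ℝ, InFemtoWindow lam β L →
      ∀ (Ω : physSubmodule L) (θ c : ℝ), IsVacuum β Ω θ → 0 < c → (∀ U, c ≤ (Ω : GaugeConfig 3 L SU2 → ℝ) U) →
        ∃ (Ω₁ : GaugeConfig 3 1 SU2 → ℝ) (ψ : Fin (N + 1) → (GaugeConfig 3 1 SU2 → ℝ)) (Λ₁ : ℝ)
          (M : ℕ) (χ : Fin M → (GaugeConfig 3 L SU2 → ℝ)) (μ : Fin M → ℝ) (Λ : ℝ)
          (j₀ : Fin (N + 1) → Fin M) (S : Fin (N + 1) → Finset (Fin M)) (δ C₁ C₂ D C_N : ℝ),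
          IsRawVacuum (liftCoupling β L) Ω₁ ∧ (∃ c₁ : ℝ, 0 < c₁ ∧ ∀ V, c₁ ≤ Ω₁ V) ∧ (∀ n, IsPhys (ψ n)) ∧
          (∀ n n', l2 (ψ n) (ψ n') = if n = n' then 1 else 0) ∧
          (∀ n : Fin (N + 1), transferApply (liftCoupling β L) (ψ n) = levelValue su2Rep 1 (liftCoupling β L) n • ψ n) ∧
          0 ≤ Λ₁ ∧ Λ₁ < levelValue su2Rep 1 (liftCoupling β L) k ∧
          (∀ ξ : GaugeConfig 3 1 SU2 → ℝ, IsPhys ξ → (∀ n, l2 ξ (ψ n) = 0) →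
            l2 ξ (transferApply (liftCoupling β L) ξ) ≤ Λ₁ * l2 ξ ξ) ∧
          (∀ j, IsPhys (χ j)) ∧ (∀ j j', l2 (χ j) (χ j') = if j = j' then 1 else 0) ∧ (∀ j, transferApply β (χ j) = μ j • χ j) ∧ 0 ≤ Λ ∧
          (∀ ξ : GaugeConfig 3 L SU2 → ℝ, IsPhys ξ → (∀ j, l2 ξ (χ j) = 0) → l2 ξ (transferApply β ξ) ≤ Λ * l2 ξ ξ) ∧
          0 ≤ C₁ ∧ 0 ≤ C₂ ∧ 0 ≤ D ∧ 0 ≤ C_N ∧ D * C_N ≤ C₁ ∧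
          4 * (N + 1) * ((C₁ + C₂) * (luscherLambda β L ^ 3 / (L : ℝ) ^ 2) * levelValue su2Rep L β 0 ^ 2 + δ ^ 2) ≤
            C * (luscherLambda β L ^ 3 / (L : ℝ) ^ 2) * levelValue su2Rep L β 0 ^ 2 ∧
          (∀ n, Λ ≤ μ (j₀ n) ∧ μ (j₀ n) ≤ levelValue su2Rep L β 0 ∧ (∀ j, j ∉ S n → μ j ≤ μ (j₀ n)) ∧
            ((dressSteps L : ℝ) + 1) ^ 2 * Λ ^ (2 * dressSteps L) ≤ μ (j₀ n) ^ (2 * dressSteps L) ∧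
            (∀ j ∈ S n, |μ j - μ (j₀ n)| * l2 (liftVec β (Ω : GaugeConfig 3 L SU2 → ℝ) (ψ n / Ω₁)) (χ j) ^ 2 ≤
              D * (luscherLambda β L / L) * levelValue su2Rep L β 0 * l2 (liftVec β (Ω : GaugeConfig 3 L SU2 → ℝ) (ψ n / Ω₁)) (χ j) ^ 2) ∧
            ∑ j ∈ S n, |μ j - μ (j₀ n)| * μ j ^ (2 * dressSteps L) * l2 (liftVec β (Ω : GaugeConfig 3 L SU2 → ℝ) (ψ n / Ω₁)) (χ j) ^ 2 ≤
              C_N * (luscherLambda β L ^ 2 / L) * levelValue su2Rep L β 0 *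
                (μ (j₀ n) ^ (2 * dressSteps L) * l2 (liftVec β (Ω : GaugeConfig 3 L SU2 → ℝ) (ψ n / Ω₁)) (χ (j₀ n)) ^ 2) ∧
            l2 (liftVec β (Ω : GaugeConfig 3 L SU2 → ℝ) (ψ n / Ω₁)) (liftVec β (Ω : GaugeConfig 3 L SU2 → ℝ) (ψ n / Ω₁)) -
                ∑ j ∈ S n, l2 (liftVec β (Ω : GaugeConfig 3 L SU2 → ℝ) (ψ n / Ω₁)) (χ j) ^ 2 ≤
              C₂ * luscherLambda β L ^ 3 * l2 (liftVec β (Ω : GaugeConfig 3 L SU2 → ℝ) (ψ n / Ω₁)) (χ (j₀ n)) ^ 2) ∧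
          (∀ n n' : Fin (N + 1), levelValue su2Rep 1 (liftCoupling β L) n = levelValue su2Rep 1 (liftCoupling β L) n' →
            (μ (j₀ n) - μ (j₀ n')) ^ 2 ≤ δ ^ 2)

/-- ★ **`FirstMomentCoreAt k → SlowOutsideCoreAt k`**: (BAND) × (NEAR₁) ⇒ (SLOW) with `C₁ ≥ D·C_N`
(`D(λ/L)λ₀ · C_N(λ²/L)λ₀ = D·C_N·(λ³/L²)λ₀²`). [cite: Luscher1983, §3] [cite: Kato1949, §1] -/
theorem slowOutsideCore_of_firstMomentCore {k : ℕ} (h : FirstMomentCoreAt k) : SlowOutsideCoreAt k := by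
  obtain ⟨N, C, lam0, hC, hlam0, hk⟩ := h
  refine ⟨N, C, lam0, hC, hlam0, fun lam hlam hle => ?_⟩
  obtain ⟨L0, hL⟩ := hk lam hlam hle
  refine ⟨L0, fun L _ hL0 β hW Ω θ c hV hc hcle => ?_⟩
  obtain ⟨Ω₁, ψ, Λ₁, M, χ, μ, Λ, j₀, S, δ, C₁, C₂, D, C_N, hΩ₁, hpos, hψ, hon, heig, hΛ₁, hΛ₁k, hdom₁, hχ, honχ, heigχ, hΛ, hdomχ,
    hC₁, hC₂, hD, hCN, hDC, hrate, hper, hwidth⟩ := hL L hL0 β hW Ω θ c hV hc hcle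
  refine ⟨Ω₁, ψ, Λ₁, M, χ, μ, Λ, j₀, S, δ, C₁, C₂, hΩ₁, hpos, hψ, hon, heig, hΛ₁, hΛ₁k, hdom₁, hχ, honχ, heigχ, hΛ, hdomχ, hC₁, hC₂,
    hrate, fun n => ?_, hwidth⟩
  obtain ⟨hΛμ, hμtop, hS, hgap, hband, hnear, hout⟩ := hper n
  refine ⟨hΛμ, hμtop, hS, hgap, ?_, hout⟩
  have hlam0' : 0 ≤ luscherLambda β L := (luscherLambda_pos_of_window hlam hW).le
  have hLpos : (0 : ℝ) < L := Nat.cast_pos.mpr (NeZero.pos L)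
  have hl0 : 0 ≤ levelValue su2Rep L β 0 := (levelValue_pos_of_window hW 0).le
  have hW0 : 0 ≤ D * (luscherLambda β L / L) * levelValue su2Rep L β 0 := mul_nonneg (mul_nonneg hD (div_nonneg hlam0' hLpos.le)) hl0
  set x := liftVec β (Ω : GaugeConfig 3 L SU2 → ℝ) (ψ n / Ω₁) with hx
  have hslow := slow_of_band_firstMoment_dressed (S n) μ (fun j => l2 x (χ j)) (μ (j₀ n)) _ _ (dressSteps L) hW0 hband hnear
  have hX : 0 ≤ (luscherLambda β L ^ 3 / (L : ℝ) ^ 2) * levelValue su2Rep L β 0 ^ 2 * (μ (j₀ n) ^ (2 * dressSteps L) * l2 x (χ (j₀ n)) ^ 2) :=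
    mul_nonneg (mul_nonneg (div_nonneg (pow_nonneg hlam0' 3) (sq_nonneg _)) (sq_nonneg _))
      (mul_nonneg (by rw [pow_mul']; exact sq_nonneg _) (sq_nonneg _))
  calc ∑ j ∈ S n, (μ j - μ (j₀ n)) ^ 2 * μ j ^ (2 * dressSteps L) * l2 x (χ j) ^ 2
      ≤ D * (luscherLambda β L / L) * levelValue su2Rep L β 0 *
          (C_N * (luscherLambda β L ^ 2 / L) * levelValue su2Rep L β 0 * (μ (j₀ n) ^ (2 * dressSteps L) * l2 x (χ (j₀ n)) ^ 2)) := hslow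
    _ = (D * C_N) * ((luscherLambda β L ^ 3 / (L : ℝ) ^ 2) * levelValue su2Rep L β 0 ^ 2 * (μ (j₀ n) ^ (2 * dressSteps L) * l2 x (χ (j₀ n)) ^ 2)) := by
        field_simp
    _ ≤ C₁ * ((luscherLambda β L ^ 3 / (L : ℝ) ^ 2) * levelValue su2Rep L β 0 ^ 2 * (μ (j₀ n) ^ (2 * dressSteps L) * l2 x (χ (j₀ n)) ^ 2)) :=
        mul_le_mul_of_nonneg_right hDC hX
    _ = C₁ * (luscherLambda β L ^ 3 / (L : ℝ) ^ 2) * levelValue su2Rep L β 0 ^ 2 * (μ (j₀ n) ^ (2 * dressSteps L) * l2 x (χ (j₀ n)) ^ 2) := by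
        ring

/-- ★★★ **S-LEAK ⟸ S-STAT + `FirstMomentCoreAt`** (registered r5 texts VERBATIM on both sides). [cite: Luscher1983, §3] [cite: LuscherWolff1990, §2] -/
theorem liftLeakage_of_statics_and_firstMomentCore
    (hS : ∀ k : ℕ, ∃ C lam0 : ℝ, 0 ≤ C ∧ 0 < lam0 ∧ ∀ lam : ℝ, 0 < lam → lam ≤ lam0 → ∃ L0 : ℕ,
      ∀ (L : ℕ) [NeZero L], L0 ≤ L → ∀ β : ℝ, InFemtoWindow lam β L →
        ∀ φ : GaugeConfig 3 L SU2 → ℝ, IsRawVacuum β φ →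
          ∀ (ω : GaugeConfig 3 1 SU2 → ℝ) (g : Fin k → (GaugeConfig 3 1 SU2 → ℝ)), LiftBasis (liftCoupling β L) k ω g →
            StaticClauses k C β (dressedLiftFamily β φ g))
    (hcore : ∀ k : ℕ, FirstMomentCoreAt k) :
    ∀ k : ℕ, ∃ C lam0 : ℝ, 0 ≤ C ∧ 0 < lam0 ∧ ∀ lam : ℝ, 0 < lam → lam ≤ lam0 → ∃ L0 : ℕ,
      ∀ (L : ℕ) [NeZero L], L0 ≤ L → ∀ β : ℝ, InFemtoWindow lam β L →
        ∀ φ : GaugeConfig 3 L SU2 → ℝ, IsRawVacuum β φ →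
          ∀ (ω : GaugeConfig 3 1 SU2 → ℝ) (g : Fin k → (GaugeConfig 3 1 SU2 → ℝ)), LiftBasis (liftCoupling β L) k ω g →
            LeakageClause k C β (dressedLiftFamily β φ g) :=
  liftLeakage_of_statics_and_core hS fun k => slowOutsideCore_of_firstMomentCore (hcore k)

end Summit.QuantumFields.YangMills.Theorems.FemtoTransferGap.LiftLeak

end
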